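import Summits.CriticalPhenomena.PercolationContinuityZ3.Theorems.PercNearOneGluingAdditiveGluingFingerTwoContacts
import Summits.CriticalPhenomena.PercolationContinuityZ3.Theorems.PercNearOneGluingAdditiveGluingFingerReachUnion
import Summits.CriticalPhenomena.PercolationContinuityZ3.Theorems.PercNearOneGluingAdditiveGluingLincombIntegral
import HarnessLib

/-! # Crux `PercNearOneGluing.AdditiveGluing` (stmt-CriticalPhenomena-4576) — HYPOTHESIS-FREE DOMINATION at two contact relays:
# the glued block's gap over `d` is at least the base-weaker contact's unglued gap (seat (b) V⁺-form, depth prover `png-dp-vplus`)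

Support file (`--supports stmt-CriticalPhenomena-4576`); no definitions, no named facts.  Setting of `fingerML3_twoContacts_core`
(`…AdditiveGluingFingerTwoContacts.lean`): finger block `N` (fingers pairwise non-adjacent) whose fingers have positive-weight pairs only to
`w₁ ≠ w₂`, `d, b ∉ N`, `g = K/N`, `q` = `K` with the pairs at `N` killed, `R` = some contact pair open, `A₀(y) = μ_q(y ↔ b)`.

**Theorem (`fingerML3_twoContacts_domination`).**  If `A₀(w₁) ≤ A₀(w₂)` (label the contacts so that `w₁` is the base-weaker one) then,
with NO hypothesis relating `d` to the contacts,
  `μ_K(R ∩ {w₁↔b}) − μ_K(R ∩ {d↔b}) ≤ μ_{K/N}(R ∩ ⋃_{v∈N}{v↔b}) − μ_{K/N}(R ∩ {d↔b})`: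
the glued block beats `d` (on `R`) by at least as much as the base-weaker contact beats `d` in the UNGLUED weighting.  This is the two-contact
case of the depth prover's domination conjecture DI-R (memo MEMO-gen4 §7: `V' ≥ min_u [μ_K(R∩u↔b) − μ_K(R∩d↔b)]` for every finger block; exact
exhaustive census 1.6 M instances, 0 violations), which implies the registered stub `stub_fingerML3_vp` for every `|A|`; it contains
`fingerML3_twoContacts_single` (there `w₁` is base-weak, so the right-hand side is `≥ μ_K(w₁↔b) − μ_K(d↔b) ≥ 0`).
**Proof.**  Pattern expansion (as in `fingerML3_twoContacts_core`): with `EX = A₁₂(w₁) − A₁₂(d)`, `Δ_i = A₀(w_i) − A₀(d)`, bridged mass `β`,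
both-touched mass `p₁₂ ≥ β` and single-touch masses `p₁, p₂`:  `V' − Γ₁ = (p₁₂ − β)(EX − Δ₁) + p₂(Δ₂ − Δ₁)`, and `EX − Δ₁ ≥ 0` is the base
GLUE-GAIN COMPARISON (`glueGain_ge_restricted` + `restricted_base_order`): pointwise in the base configuration
`[w₁∨w₂ ↔ b] − [d ↔ b after gluing w₁w₂] − [w₁↔b] + [d↔b] ≥ [w₂↔b, w₁↮d] − [w₁↔b, w₁↮d]` (inclusion), and
`μ_q(w₂↔b, w₁↮d) ≥ μ_q(w₁↔b, w₁↮d)` is Kozma–Nitzan's Lemma 3(ii) in the base (`w₁` base-weaker, `{w₁ ↮ d}` decreasing in `C_{w₁}`).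
[cite: KozmaNitzan2024, Lemma 3(ii) (pp. 6–7), Thm 4 (pp. 12–14), §3.1, §4 p. 20, Question 9 (p. 36)]
-/

namespace Summit.CriticalPhenomena.PercolationContinuityZ3.Theorems

open MeasureTheory Set
open Literature.Probability.LatticeModels (prodBernoulli)
open Literature.Probability.Percolation (BondConfig openConn openGraph pinW localCylinder DeterminedBy determinedBy_iff)

noncomputable section
open Classical

section FingerTwoContactsDomination

open Literature.Probability.LatticeModels Literature.Probability.Percolation

variable {n : ℕ}

/-- Pointwise heart of the glue-gain comparison: for the reachability relation of one configuration (only the four transitivity facts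
are used), `[w₁∨w₂ ↔ b] − [d ↔ b after gluing w₁w₂] − [w₁↔b] + [d↔b] ≥ [w₂↔b ∧ w₁↮d] − [w₁↔b ∧ w₁↮d]`, as a non-negative linear
combination of indicators. [folklore] -/
theorem glueGain_pointwise (K : Sym2 (Fin n) → unitInterval) (N : Finset (Fin n)) (w₁ w₂ d b : Fin n) (h12 : w₁ ≠ w₂)
    (ω : BondConfig (Fin n)) :
    0 ≤ (([((1 : ℝ), {ω : BondConfig (Fin n) | (openGraph (({e | e ∈ ω ∧ ∀ z ∈ e, z ∉ N} ∪ {s(w₁, w₂)} : Set (Sym2 (Fin n))) :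
          BondConfig (Fin n))).Reachable w₁ b}),
      ((-1 : ℝ), {ω : BondConfig (Fin n) | (openGraph (({e | e ∈ ω ∧ ∀ z ∈ e, z ∉ N} ∪ {s(w₁, w₂)} : Set (Sym2 (Fin n))) :
          BondConfig (Fin n))).Reachable d b}),
      ((-1 : ℝ), {ω : BondConfig (Fin n) | (openGraph (({e | e ∈ ω ∧ ∀ z ∈ e, z ∉ N} ∪ (∅ : Set (Sym2 (Fin n))) : Set (Sym2 (Fin n))) :
          BondConfig (Fin n))).Reachable w₁ b}),
      ((1 : ℝ), {ω : BondConfig (Fin n) | (openGraph (({e | e ∈ ω ∧ ∀ z ∈ e, z ∉ N} ∪ (∅ : Set (Sym2 (Fin n))) : Set (Sym2 (Fin n))) :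
          BondConfig (Fin n))).Reachable d b}),
      ((-1 : ℝ), {ω : BondConfig (Fin n) | (openGraph (({e | e ∈ ω ∧ ∀ z ∈ e, z ∉ N} ∪ (∅ : Set (Sym2 (Fin n))) : Set (Sym2 (Fin n))) :
          BondConfig (Fin n))).Reachable w₂ b ∧ ¬ (openGraph (({e | e ∈ ω ∧ ∀ z ∈ e, z ∉ N} ∪ (∅ : Set (Sym2 (Fin n))) :
          Set (Sym2 (Fin n))) : BondConfig (Fin n))).Reachable w₁ d}),
      ((1 : ℝ), {ω : BondConfig (Fin n) | (openGraph (({e | e ∈ ω ∧ ∀ z ∈ e, z ∉ N} ∪ (∅ : Set (Sym2 (Fin n))) : Set (Sym2 (Fin n))) :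
          BondConfig (Fin n))).Reachable w₁ b ∧ ¬ (openGraph (({e | e ∈ ω ∧ ∀ z ∈ e, z ∉ N} ∪ (∅ : Set (Sym2 (Fin n))) :
          Set (Sym2 (Fin n))) : BondConfig (Fin n))).Reachable w₁ d})] : List (ℝ × Set (BondConfig (Fin n)))).map
      fun ce => ce.1 * ce.2.indicator (1 : BondConfig (Fin n) → ℝ) ω).sum := by
  have _ := K
  have e0 : ((({e | e ∈ ω ∧ ∀ z ∈ e, z ∉ N} : Set (Sym2 (Fin n))) ∪ (∅ : Set (Sym2 (Fin n)))) : Set (Sym2 (Fin n))) =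
      {e | e ∈ ω ∧ ∀ z ∈ e, z ∉ N} := Set.union_empty _
  have k1 : (openGraph ((({e | e ∈ ω ∧ ∀ z ∈ e, z ∉ N} : Set (Sym2 (Fin n))) ∪ {s(w₁, w₂)}) : BondConfig (Fin n))).Reachable w₁ b ↔
      ((openGraph ((({e | e ∈ ω ∧ ∀ z ∈ e, z ∉ N} : Set (Sym2 (Fin n))) ∪ (∅ : Set (Sym2 (Fin n)))) : BondConfig (Fin n))).Reachable w₁ b ∨ (openGraph ((({e | e ∈ ω ∧ ∀ z ∈ e, z ∉ N} : Set (Sym2 (Fin n))) ∪ (∅ : Set (Sym2 (Fin n)))) : BondConfig (Fin n))).Reachable w₂ b) := by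
    rw [e0, reach_union_pair_iff w₁ w₂ h12 w₁ b]
    have hr := SimpleGraph.Reachable.refl (G := openGraph (({e | e ∈ ω ∧ ∀ z ∈ e, z ∉ N} : Set (Sym2 (Fin n))) : BondConfig (Fin n))) w₁
    tauto
  have kd : (openGraph ((({e | e ∈ ω ∧ ∀ z ∈ e, z ∉ N} : Set (Sym2 (Fin n))) ∪ {s(w₁, w₂)}) : BondConfig (Fin n))).Reachable d b ↔
      ((openGraph ((({e | e ∈ ω ∧ ∀ z ∈ e, z ∉ N} : Set (Sym2 (Fin n))) ∪ (∅ : Set (Sym2 (Fin n)))) : BondConfig (Fin n))).Reachable d b ∨ (((openGraph ((({e | e ∈ ω ∧ ∀ z ∈ e, z ∉ N} : Set (Sym2 (Fin n))) ∪ (∅ : Set (Sym2 (Fin n)))) : BondConfig (Fin n))).Reachable d w₁ ∨ (openGraph ((({e | e ∈ ω ∧ ∀ z ∈ e, z ∉ N} : Set (Sym2 (Fin n))) ∪ (∅ : Set (Sym2 (Fin n)))) : BondConfig (Fin n))).Reachable d w₂) ∧ ((openGraph ((({e | e ∈ ω ∧ ∀ z ∈ e, z ∉ N} : Set (Sym2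 (Fin n))) ∪ (∅ : Set (Sym2 (Fin n)))) : BondConfig (Fin n))).Reachable w₁ b ∨ (openGraph ((({e | e ∈ ω ∧ ∀ z ∈ e, z ∉ N} : Set (Sym2 (Fin n))) ∪ (∅ : Set (Sym2 (Fin n)))) : BondConfig (Fin n))).Reachable w₂ b))) := by
    rw [e0]
    exact reach_union_pair_iff w₁ w₂ h12 d b
  simp only [List.map_cons, List.map_nil, List.sum_cons, List.sum_nil, Set.indicator_apply, Set.mem_setOf_eq, Pi.one_apply]
  by_cases h1 : (openGraph ((({e | e ∈ ω ∧ ∀ z ∈ e, z ∉ N} : Set (Sym2 (Fin n))) ∪ (∅ : Set (Sym2 (Fin n)))) : BondConfig (Fin n))).Reachable w₁ b <;>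
  by_cases h2 : (openGraph ((({e | e ∈ ω ∧ ∀ z ∈ e, z ∉ N} : Set (Sym2 (Fin n))) ∪ (∅ : Set (Sym2 (Fin n)))) : BondConfig (Fin n))).Reachable w₂ b <;>
  by_cases h3 : (openGraph ((({e | e ∈ ω ∧ ∀ z ∈ e, z ∉ N} : Set (Sym2 (Fin n))) ∪ (∅ : Set (Sym2 (Fin n)))) : BondConfig (Fin n))).Reachable d b <;>
  by_cases h4 : (openGraph ((({e | e ∈ ω ∧ ∀ z ∈ e, z ∉ N} : Set (Sym2 (Fin n))) ∪ (∅ : Set (Sym2 (Fin n)))) : BondConfig (Fin n))).Reachable w₁ d <;>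
  by_cases h5 : (openGraph ((({e | e ∈ ω ∧ ∀ z ∈ e, z ∉ N} : Set (Sym2 (Fin n))) ∪ (∅ : Set (Sym2 (Fin n)))) : BondConfig (Fin n))).Reachable d w₂
  all_goals first
    | exact absurd (h4.symm.trans h1) h3
    | exact absurd (h5.trans h2) h3
    | exact absurd (h1.trans h3.symm) h4
    | exact absurd (h3.trans h2.symm) h5
    | (have h4' : (openGraph ((({e | e ∈ ω ∧ ∀ z ∈ e, z ∉ N} : Set (Sym2 (Fin n))) ∪ (∅ : Set (Sym2 (Fin n)))) : BondConfig (Fin n))).Reachable d w₁ ↔ (openGraph ((({e | e ∈ ω ∧ ∀ z ∈ e, z ∉ N} : Set (Sym2 (Fin n))) ∪ (∅ : Set (Sym2 (Fin n)))) : BondConfig (Fin n))).Reachable w₁ d := ⟨fun h => h.symm, fun h => h.symm⟩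
       simp only [k1, kd, h4', h1, h2, h3, h4, h5, or_true, or_false, and_true, and_false,
         not_true, not_false_iff, if_true, if_false]
       norm_num)

/-- **Glue-gain comparison in the base.**  `q` = `K` with the pairs at `N` killed; `A_Q(y) = μ_q{y ↔ b in (ω ∖ pairs at N) ∪ Q}`.  Then
`(A₁₂(w₁) − A₁₂(d)) − (A₀(w₁) − A₀(d)) ≥ μ_q{w₂↔b, w₁↮d} − μ_q{w₁↔b, w₁↮d}` (integrate `glueGain_pointwise`). [folklore] -/
theorem glueGain_ge_restricted (K : Sym2 (Fin n) → unitInterval) (N : Finset (Fin n)) (w₁ w₂ d b : Fin n) (h12 : w₁ ≠ w₂) :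
    (prodBernoulli (fun e : Sym2 (Fin n) => if (∃ z ∈ e, z ∈ N) then (0 : unitInterval) else K e)).real
        {ω : BondConfig (Fin n) | (openGraph (({e | e ∈ ω ∧ ∀ z ∈ e, z ∉ N} ∪ (∅ : Set (Sym2 (Fin n))) : Set (Sym2 (Fin n))) :
          BondConfig (Fin n))).Reachable w₂ b ∧ ¬ (openGraph (({e | e ∈ ω ∧ ∀ z ∈ e, z ∉ N} ∪ (∅ : Set (Sym2 (Fin n))) :
          Set (Sym2 (Fin n))) : BondConfig (Fin n))).Reachable w₁ d} -
      (prodBernoulli (fun e : Sym2 (Fin n) => if (∃ z ∈ e, z ∈ N) then (0 : unitInterval) else K e)).real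
        {ω : BondConfig (Fin n) | (openGraph (({e | e ∈ ω ∧ ∀ z ∈ e, z ∉ N} ∪ (∅ : Set (Sym2 (Fin n))) : Set (Sym2 (Fin n))) :
          BondConfig (Fin n))).Reachable w₁ b ∧ ¬ (openGraph (({e | e ∈ ω ∧ ∀ z ∈ e, z ∉ N} ∪ (∅ : Set (Sym2 (Fin n))) :
          Set (Sym2 (Fin n))) : BondConfig (Fin n))).Reachable w₁ d} ≤
    ((prodBernoulli (fun e : Sym2 (Fin n) => if (∃ z ∈ e, z ∈ N) then (0 : unitInterval) else K e)).real
        {ω : BondConfig (Fin n) | (openGraph (({e | e ∈ ω ∧ ∀ z ∈ e, z ∉ N} ∪ {s(w₁, w₂)} : Set (Sym2 (Fin n))) :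
          BondConfig (Fin n))).Reachable w₁ b} -
      (prodBernoulli (fun e : Sym2 (Fin n) => if (∃ z ∈ e, z ∈ N) then (0 : unitInterval) else K e)).real
        {ω : BondConfig (Fin n) | (openGraph (({e | e ∈ ω ∧ ∀ z ∈ e, z ∉ N} ∪ {s(w₁, w₂)} : Set (Sym2 (Fin n))) :
          BondConfig (Fin n))).Reachable d b}) -
    ((prodBernoulli (fun e : Sym2 (Fin n) => if (∃ z ∈ e, z ∈ N) then (0 : unitInterval) else K e)).real
        {ω : BondConfig (Fin n) | (openGraph (({e | e ∈ ω ∧ ∀ z ∈ e, z ∉ N} ∪ (∅ : Set (Sym2 (Fin n))) : Set (Sym2 (Fin n))) :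
          BondConfig (Fin n))).Reachable w₁ b} -
      (prodBernoulli (fun e : Sym2 (Fin n) => if (∃ z ∈ e, z ∈ N) then (0 : unitInterval) else K e)).real
        {ω : BondConfig (Fin n) | (openGraph (({e | e ∈ ω ∧ ∀ z ∈ e, z ∉ N} ∪ (∅ : Set (Sym2 (Fin n))) : Set (Sym2 (Fin n))) :
          BondConfig (Fin n))).Reachable d b}) := by
  have hpt := fun ω => glueGain_pointwise K N w₁ w₂ d b h12 ω
  have hint := stub_lincombIntegral_c7 n (fun e : Sym2 (Fin n) => if (∃ z ∈ e, z ∈ N) then (0 : unitInterval) else K e) _ hpt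
  simp only [List.map_cons, List.map_nil, List.sum_cons, List.sum_nil, add_zero] at hint
  linarith

/-- **Restricted base order** (Kozma–Nitzan Lemma 3(ii) in the base, read off the pairs avoiding the block): if `A₀(w₁) ≤ A₀(w₂)` then
`μ_q{w₁↔b, w₁↮d} ≤ μ_q{w₂↔b, w₁↮d}` for the star-killed events. [cite: KozmaNitzan2024, Lemma 3(ii) (pp. 6–7)] -/
theorem restricted_base_order (K : Sym2 (Fin n) → unitInterval) (N : Finset (Fin n)) (w₁ w₂ d b : Fin n)
    (horder : (prodBernoulli (fun e : Sym2 (Fin n) => if (∃ z ∈ e, z ∈ N) then (0 : unitInterval) else K e)).real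
        {ω : BondConfig (Fin n) | (openGraph (({e | e ∈ ω ∧ ∀ z ∈ e, z ∉ N} ∪ (∅ : Set (Sym2 (Fin n))) : Set (Sym2 (Fin n))) :
          BondConfig (Fin n))).Reachable w₁ b} ≤
      (prodBernoulli (fun e : Sym2 (Fin n) => if (∃ z ∈ e, z ∈ N) then (0 : unitInterval) else K e)).real
        {ω : BondConfig (Fin n) | (openGraph (({e | e ∈ ω ∧ ∀ z ∈ e, z ∉ N} ∪ (∅ : Set (Sym2 (Fin n))) : Set (Sym2 (Fin n))) :
          BondConfig (Fin n))).Reachable w₂ b}) :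
    (prodBernoulli (fun e : Sym2 (Fin n) => if (∃ z ∈ e, z ∈ N) then (0 : unitInterval) else K e)).real
        {ω : BondConfig (Fin n) | (openGraph (({e | e ∈ ω ∧ ∀ z ∈ e, z ∉ N} ∪ (∅ : Set (Sym2 (Fin n))) : Set (Sym2 (Fin n))) :
          BondConfig (Fin n))).Reachable w₁ b ∧ ¬ (openGraph (({e | e ∈ ω ∧ ∀ z ∈ e, z ∉ N} ∪ (∅ : Set (Sym2 (Fin n))) :
          Set (Sym2 (Fin n))) : BondConfig (Fin n))).Reachable w₁ d} ≤
      (prodBernoulli (fun e : Sym2 (Fin n) => if (∃ z ∈ e, z ∈ N) then (0 : unitInterval) else K e)).real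
        {ω : BondConfig (Fin n) | (openGraph (({e | e ∈ ω ∧ ∀ z ∈ e, z ∉ N} ∪ (∅ : Set (Sym2 (Fin n))) : Set (Sym2 (Fin n))) :
          BondConfig (Fin n))).Reachable w₂ b ∧ ¬ (openGraph (({e | e ∈ ω ∧ ∀ z ∈ e, z ∉ N} ∪ (∅ : Set (Sym2 (Fin n))) :
          Set (Sym2 (Fin n))) : BondConfig (Fin n))).Reachable w₁ d} := by
  set q : Sym2 (Fin n) → unitInterval := fun e => if (∃ z ∈ e, z ∈ N) then (0 : unitInterval) else K e with hq
  -- a.e. under `q` the configuration has no pair at `N`, so the star-killed events are the plain ones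
  have hae : ∀ᵐ ω ∂(prodBernoulli q), openGraph ω =
      openGraph (({e | e ∈ ω ∧ ∀ z ∈ e, z ∉ N} ∪ ↑(∅ : Finset (Sym2 (Fin n))) : Set (Sym2 (Fin n))) : BondConfig (Fin n)) := by
    refine ae_openGraph_eq_blockPairs q N ∅ (fun e he => by simp at he) ?_
    intro e _ _ hz
    show (if (∃ z ∈ e, z ∈ N) then (0 : unitInterval) else K e) = 0
    rw [if_pos hz]
  have hev0 : ∀ x : Fin n,
      {ω : BondConfig (Fin n) | (openGraph (({e | e ∈ ω ∧ ∀ z ∈ e, z ∉ N} ∪ (∅ : Set (Sym2 (Fin n))) : Set (Sym2 (Fin n))) :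
          BondConfig (Fin n))).Reachable x b} =ᵐ[prodBernoulli q] (openConn x b : Set (BondConfig (Fin n))) := by
    intro x
    filter_upwards [hae] with ω hω
    simp only [Finset.coe_empty] at hω
    refine propext ⟨fun h => ?_, fun h => ?_⟩
    · show (openGraph ω).Reachable x b
      rw [hω]; exact h
    · have h' : (openGraph ω).Reachable x b := h
      rw [hω] at h'; exact h'
  have hnd : ∀ x : Fin n,
      {ω : BondConfig (Fin n) | (openGraph (({e | e ∈ ω ∧ ∀ z ∈ e, z ∉ N} ∪ (∅ : Set (Sym2 (Fin n))) : Set (Sym2 (Fin n))) :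
          BondConfig (Fin n))).Reachable x b ∧ ¬ (openGraph (({e | e ∈ ω ∧ ∀ z ∈ e, z ∉ N} ∪ (∅ : Set (Sym2 (Fin n))) :
          Set (Sym2 (Fin n))) : BondConfig (Fin n))).Reachable w₁ d} =ᵐ[prodBernoulli q]
        (openConn x b ∩ {ω : BondConfig (Fin n) | ∀ u ∈ ({d} : Set (Fin n)), ¬ (openGraph ω).Reachable w₁ u} :
          Set (BondConfig (Fin n))) := by
    intro x
    filter_upwards [hae] with ω hω
    simp only [Finset.coe_empty] at hω
    refine propext ⟨fun h => ⟨?_, fun u hu => ?_⟩, fun h => ⟨?_, ?_⟩⟩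
    · show (openGraph ω).Reachable x b
      rw [hω]; exact h.1
    · rw [Set.mem_singleton_iff.1 hu, hω]; exact h.2
    · have h' : (openGraph ω).Reachable x b := h.1
      rw [hω] at h'; exact h'
    · have h2 := h.2 d (Set.mem_singleton d)
      rw [hω] at h2; exact h2
  have horder' : (prodBernoulli q).real (openConn w₁ b) ≤ (prodBernoulli q).real (openConn w₂ b) := by
    rw [← measureReal_congr (hev0 w₁), ← measureReal_congr (hev0 w₂)]
    exact horder
  have h3 := KozmaNitzan2024_lemma3_ii_notConn q w₁ w₂ b ({d} : Set (Fin n)) horder'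
  rw [measureReal_congr (hnd w₁), measureReal_congr (hnd w₂)]
  exact h3

/-- **Domination at two contacts (hypothesis-free).**  See the module docstring. [cite: KozmaNitzan2024, Lemma 3(ii) (pp. 6–7), Thm 4 (pp. 12–14), §3.1, §4 p. 20] -/
theorem fingerML3_twoContacts_domination (K : Sym2 (Fin n) → unitInterval) (N : Finset (Fin n)) (w₁ w₂ d b : Fin n)
    (hw₁ : w₁ ∉ N) (hw₂ : w₂ ∉ N) (h12 : w₁ ≠ w₂) (hdN : d ∉ N) (hbN : b ∉ N)
    (hint : ∀ v ∈ N, ∀ v' ∈ N, v ≠ v' → K s(v, v') = 0)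
    (hcont : ∀ v ∈ N, ∀ z : Fin n, z ∉ N → z ≠ w₁ → z ≠ w₂ → K s(v, z) = 0)
    (horder : (prodBernoulli (fun e : Sym2 (Fin n) => if (∃ z ∈ e, z ∈ N) then (0 : unitInterval) else K e)).real
        {ω : BondConfig (Fin n) | (openGraph (({e | e ∈ ω ∧ ∀ z ∈ e, z ∉ N} ∪ (∅ : Set (Sym2 (Fin n))) : Set (Sym2 (Fin n))) :
          BondConfig (Fin n))).Reachable w₁ b} ≤
      (prodBernoulli (fun e : Sym2 (Fin n) => if (∃ z ∈ e, z ∈ N) then (0 : unitInterval) else K e)).real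
        {ω : BondConfig (Fin n) | (openGraph (({e | e ∈ ω ∧ ∀ z ∈ e, z ∉ N} ∪ (∅ : Set (Sym2 (Fin n))) : Set (Sym2 (Fin n))) :
          BondConfig (Fin n))).Reachable w₂ b}) :
    (prodBernoulli K).real
        ({ω : Set (Sym2 (Fin n)) | ∃ e ∈ N.image (fun v => s(v, w₁)) ∪ N.image (fun v => s(v, w₂)), e ∈ ω} ∩ openConn w₁ b) -
      (prodBernoulli K).real
        ({ω : Set (Sym2 (Fin n)) | ∃ e ∈ N.image (fun v => s(v, w₁)) ∪ N.image (fun v => s(v, w₂)), e ∈ ω} ∩ openConn d b) ≤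
    (prodBernoulli (fun e' : Sym2 (Fin n) => if (∀ z ∈ e', z ∈ N) ∧ ¬ e'.IsDiag then 1 else K e')).real
        ({ω : Set (Sym2 (Fin n)) | ∃ e ∈ N.image (fun v => s(v, w₁)) ∪ N.image (fun v => s(v, w₂)), e ∈ ω} ∩
          ⋃ v ∈ N, openConn v b) -
      (prodBernoulli (fun e' : Sym2 (Fin n) => if (∀ z ∈ e', z ∈ N) ∧ ¬ e'.IsDiag then 1 else K e')).real
        ({ω : Set (Sym2 (Fin n)) | ∃ e ∈ N.image (fun v => s(v, w₁)) ∪ N.image (fun v => s(v, w₂)), e ∈ ω} ∩ openConn d b) := by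
  set F : Finset (Sym2 (Fin n)) := N.image (fun v => s(v, w₁)) ∪ N.image (fun v => s(v, w₂)) with hFdef
  set g : Sym2 (Fin n) → unitInterval := fun e' => if (∀ z ∈ e', z ∈ N) ∧ ¬ e'.IsDiag then 1 else K e' with hg
  set q : Sym2 (Fin n) → unitInterval := fun e => if (∃ z ∈ e, z ∈ N) then (0 : unitInterval) else K e with hq
  -- the base quantities `A₀`, `A₁₂`
  set A0 : Fin n → ℝ := fun y => (prodBernoulli q).real
        {ω : BondConfig (Fin n) | (openGraph (({e | e ∈ ω ∧ ∀ z ∈ e, z ∉ N} ∪ (∅ : Set (Sym2 (Fin n))) : Set (Sym2 (Fin n))) :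
          BondConfig (Fin n))).Reachable y b} with hA0
  set A12 : Fin n → ℝ := fun y => (prodBernoulli q).real
        {ω : BondConfig (Fin n) | (openGraph (({e | e ∈ ω ∧ ∀ z ∈ e, z ∉ N} ∪ {s(w₁, w₂)} : Set (Sym2 (Fin n))) :
          BondConfig (Fin n))).Reachable y b} with hA12
  have hΔ₁₂ : A0 w₁ ≤ A0 w₂ := horder
  -- the base glue-gain comparison `EX − Δ₁ ≥ 0` (pointwise inclusion + Kozma–Nitzan Lemma 3(ii) in the base)
  have hgain : 0 ≤ (A12 w₁ - A12 d) - (A0 w₁ - A0 d) := by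
    have hg := glueGain_ge_restricted K N w₁ w₂ d b h12
    have hL := restricted_base_order K N w₁ w₂ d b horder
    have e1 : A12 w₁ = _ := rfl
    linarith [hg, hL]
  have hmeas : ∀ s : Set (BondConfig (Fin n)), MeasurableSet s := fun _ => MeasurableSet.of_discrete
  -- the contact pairs
  have hFmem : ∀ e ∈ F, ∃ v ∈ N, e = s(v, w₁) ∨ e = s(v, w₂) := by
    intro e he
    rcases Finset.mem_union.1 he with h | h
    · obtain ⟨v, hv, rfl⟩ := Finset.mem_image.1 h
      exact ⟨v, hv, Or.inl rfl⟩
    · obtain ⟨v, hv, rfl⟩ := Finset.mem_image.1 h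
      exact ⟨v, hv, Or.inr rfl⟩
  have hgK : ∀ e ∈ (↑F : Set (Sym2 (Fin n))), g e = K e := by
    intro e he
    obtain ⟨v, -, h⟩ := hFmem e (Finset.mem_coe.1 he)
    have hnot : ¬ ((∀ z ∈ e, z ∈ N) ∧ ¬ e.IsDiag) := by
      rintro ⟨hall, -⟩
      rcases h with rfl | rfl
      · exact hw₁ (hall w₁ (Sym2.mem_mk_right v w₁))
      · exact hw₂ (hall w₂ (Sym2.mem_mk_right v w₂))
    simp only [hg, hnot, if_false]
  -- the event `R` and the pattern sum over it (index set abstracted)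
  set R : Set (BondConfig (Fin n)) := {ω : Set (Sym2 (Fin n)) | ∃ e ∈ F, e ∈ ω} with hR
  have hdetR : DeterminedBy R (↑F : Set (Sym2 (Fin n))) := DepthOneGluing.determinedBy_exists_mem F
  obtain ⟨S, hS, hsum⟩ : ∃ S : Finset (Finset (Sym2 (Fin n))), (∀ T ∈ S, T ⊆ F ∧ ∃ e ∈ F, e ∈ T) ∧
      ∀ (p : Sym2 (Fin n) → unitInterval) (A : Set (BondConfig (Fin n))), (prodBernoulli p).real (A ∩ R) =
        ∑ T ∈ S, (prodBernoulli p).real (localCylinder (↑F : Set (Sym2 (Fin n))) ↑T) *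
          (prodBernoulli (pinW p (↑F : Set (Sym2 (Fin n))) ↑T)).real A := by
    refine ⟨@Finset.filter _ (fun T : Finset (Sym2 (Fin n)) => (↑T : Set (Sym2 (Fin n))) ∈ R) (_) F.powerset, ?_,
      fun p A => prodBernoulli_real_inter_eq_sum_pinW p F (hmeas A) hdetR⟩
    intro T hT
    obtain ⟨hTF, hTR⟩ := (@Finset.mem_filter _ _ (_) _ _).1 hT
    refine ⟨Finset.mem_powerset.1 hTF, ?_⟩
    simpa [hR] using hTR
  -- cylinder weights (equal under `K` and `K/N`: the pairs of `F` are not internal)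
  set cyl : Finset (Sym2 (Fin n)) → ℝ := fun T => (prodBernoulli K).real (localCylinder (↑F : Set (Sym2 (Fin n))) ↑T) with hcyl
  have hcyl_nonneg : ∀ T, 0 ≤ cyl T := fun T => measureReal_nonneg
  have hcylg : ∀ T : Finset (Sym2 (Fin n)), (prodBernoulli g).real (localCylinder (↑F : Set (Sym2 (Fin n))) ↑T) = cyl T :=
    fun T => prodBernoulli_real_eq_of_determinedBy g K hgK (determinedBy_localCylinder _ _) (hmeas _)
  -- touched / bridged patterns
  set t1 : Finset (Sym2 (Fin n)) → Prop := fun T => ∃ v ∈ N, s(v, w₁) ∈ T with ht1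
  set t2 : Finset (Sym2 (Fin n)) → Prop := fun T => ∃ v ∈ N, s(v, w₂) ∈ T with ht2
  set br : Finset (Sym2 (Fin n)) → Prop := fun T => ∃ v ∈ N, s(v, w₁) ∈ T ∧ s(v, w₂) ∈ T with hbr
  have hbr_both : ∀ T, br T → t1 T ∧ t2 T := fun T ⟨v, hv, h1, h2⟩ => ⟨⟨v, hv, h1⟩, ⟨v, hv, h2⟩⟩
  have htouched : ∀ T ∈ S, t1 T ∨ t2 T := by
    intro T hT
    obtain ⟨-, e, heF, heT⟩ := hS T hT
    obtain ⟨v, hv, h⟩ := hFmem e heF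
    rcases h with rfl | rfl
    · exact Or.inl ⟨v, hv, heT⟩
    · exact Or.inr ⟨v, hv, heT⟩
  -- pattern reliabilities, unglued (`K`)
  have hvK : ∀ T, T ⊆ F → ∀ y, y ∉ N →
      (prodBernoulli (pinW K (↑F : Set (Sym2 (Fin n))) ↑T)).real (openConn y b) = if br T then A12 y else A0 y := by
    intro T hTF y hy
    by_cases hb : br T
    · rw [if_pos hb]
      exact real_openConn_pinW_unglued_bridged K N w₁ w₂ b hw₁ hw₂ h12 hint hcont T hTF hb hy hbN
    · rw [if_neg hb]
      exact real_openConn_pinW_unglued_unbridged K N w₁ w₂ b hw₁ hw₂ hint hcont T hTF hb hy hbN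
  -- pattern reliabilities, glued (`K/N`)
  have hvg : ∀ T, T ⊆ F → ∀ y, y ∉ N →
      (prodBernoulli (pinW g (↑F : Set (Sym2 (Fin n))) ↑T)).real (openConn y b) = if (t1 T ∧ t2 T) then A12 y else A0 y := by
    intro T hTF y hy
    by_cases hb : t1 T ∧ t2 T
    · rw [if_pos hb]
      exact real_openConn_pinW_glued K N w₁ w₂ b hw₁ hw₂ h12 hcont T hTF {s(w₁, w₂)} (Or.inl ⟨hb, rfl⟩) hy hbN
    · rw [if_neg hb]
      exact real_openConn_pinW_glued K N w₁ w₂ b hw₁ hw₂ h12 hcont T hTF ∅ (Or.inr ⟨hb, rfl⟩) hy hbN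
  have hvgU : ∀ T, T ⊆ F → (t1 T ∨ t2 T) →
      (prodBernoulli (pinW g (↑F : Set (Sym2 (Fin n))) ↑T)).real (⋃ v ∈ N, openConn v b) =
        if (t1 T ∧ t2 T) then A12 w₁ else if t1 T then A0 w₁ else A0 w₂ := by
    intro T hTF ht
    by_cases h1 : t1 T
    · obtain ⟨v₁, hv₁, hv₁T⟩ := h1
      rw [real_blockReach_pinW_glued K N w₁ w₂ b hw₁ hw₂ T hTF hv₁ hw₁ hv₁T, hvg T hTF w₁ hw₁]
      by_cases hb : t1 T ∧ t2 T
      · rw [if_pos hb, if_pos hb]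
      · rw [if_neg hb, if_neg hb, if_pos ⟨v₁, hv₁, hv₁T⟩]
    · obtain ⟨v₂, hv₂, hv₂T⟩ := ht.resolve_left h1
      have hb : ¬ (t1 T ∧ t2 T) := fun h => h1 h.1
      rw [real_blockReach_pinW_glued K N w₁ w₂ b hw₁ hw₂ T hTF hv₂ hw₂ hv₂T, hvg T hTF w₂ hw₂, if_neg hb, if_neg hb, if_neg h1]
  -- the no-contact cylinder
  have hRc : Rᶜ = localCylinder (↑F : Set (Sym2 (Fin n))) (∅ : Set (Sym2 (Fin n))) := notSomeOpen_eq_localCylinder F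
  set c0 : ℝ := (prodBernoulli K).real (localCylinder (↑F : Set (Sym2 (Fin n))) (∅ : Set (Sym2 (Fin n)))) with hc0
  have hc0_nonneg : 0 ≤ c0 := measureReal_nonneg
  have hpin0 : ∀ y, y ∉ N → (prodBernoulli (pinW K (↑F : Set (Sym2 (Fin n))) (∅ : Set (Sym2 (Fin n))))).real (openConn y b) = A0 y := by
    intro y hy
    have h := hvK ∅ (Finset.empty_subset F) y hy
    rw [Finset.coe_empty] at h
    rw [h, if_neg]
    rintro ⟨v, -, hv, -⟩
    simp at hv
  -- unglued reliabilities expanded over the patterns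
  have hτ : ∀ y, y ∉ N → (prodBernoulli K).real (openConn y b) =
      (∑ T ∈ S, cyl T * (if br T then A12 y else A0 y)) + c0 * A0 y := by
    intro y hy
    have hs := measureReal_inter_add_sdiff (μ := prodBernoulli K) (s := (openConn y b : Set (BondConfig (Fin n)))) (hmeas R)
    rw [Set.sdiff_eq, hRc, prodBernoulli_real_inter_localCylinder K F ∅ (hmeas _), hpin0 y hy, hsum K] at hs
    rw [← hs]
    congr 1
    refine Finset.sum_congr rfl fun T hT => ?_
    rw [hvK T (hS T hT).1 y hy]
  -- total mass of the patterns
  have hmass : (∑ T ∈ S, cyl T) + c0 = 1 := by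
    have hs := measureReal_inter_add_sdiff (μ := prodBernoulli K) (s := (Set.univ : Set (BondConfig (Fin n)))) (hmeas R)
    rw [Set.sdiff_eq, hRc, prodBernoulli_real_inter_localCylinder K F ∅ (hmeas _), hsum K, probReal_univ, probReal_univ,
      mul_one] at hs
    rw [← hs]
    congr 1
    refine Finset.sum_congr rfl fun T _ => ?_
    rw [probReal_univ, mul_one]
  -- glued sides expanded over the patterns
  have hgd : (prodBernoulli g).real (R ∩ openConn d b) = ∑ T ∈ S, cyl T * (if (t1 T ∧ t2 T) then A12 d else A0 d) := by
    rw [Set.inter_comm, hsum g]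
    refine Finset.sum_congr rfl fun T hT => ?_
    rw [hcylg T, hvg T (hS T hT).1 d hdN]
  have hgU : (prodBernoulli g).real (R ∩ ⋃ v ∈ N, openConn v b) =
      ∑ T ∈ S, cyl T * (if (t1 T ∧ t2 T) then A12 w₁ else if t1 T then A0 w₁ else A0 w₂) := by
    rw [Set.inter_comm, hsum g]
    refine Finset.sum_congr rfl fun T hT => ?_
    rw [hcylg T, hvgU T (hS T hT).1 (htouched T hT)]
  -- the aggregated weights
  set β : ℝ := ∑ T ∈ S, cyl T * (if br T then 1 else 0) with hβ
  set uR : ℝ := ∑ T ∈ S, cyl T * (if br T then 0 else 1) with huR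
  set p12 : ℝ := ∑ T ∈ S, cyl T * (if (t1 T ∧ t2 T) then 1 else 0) with hp12
  set p1 : ℝ := ∑ T ∈ S, cyl T * (if (t1 T ∧ t2 T) then 0 else if t1 T then 1 else 0) with hp1
  set p2 : ℝ := ∑ T ∈ S, cyl T * (if (t1 T ∧ t2 T) then 0 else if t1 T then 0 else 1) with hp2
  have hβ_nonneg : 0 ≤ β := Finset.sum_nonneg fun T _ => mul_nonneg (hcyl_nonneg T) (by split_ifs <;> norm_num)
  have huR_nonneg : 0 ≤ uR := Finset.sum_nonneg fun T _ => mul_nonneg (hcyl_nonneg T) (by split_ifs <;> norm_num)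
  have hp12_nonneg : 0 ≤ p12 := Finset.sum_nonneg fun T _ => mul_nonneg (hcyl_nonneg T) (by split_ifs <;> norm_num)
  have hp1_nonneg : 0 ≤ p1 := Finset.sum_nonneg fun T _ => mul_nonneg (hcyl_nonneg T) (by split_ifs <;> norm_num)
  have hp2_nonneg : 0 ≤ p2 := Finset.sum_nonneg fun T _ => mul_nonneg (hcyl_nonneg T) (by split_ifs <;> norm_num)
  have hβu : β + uR = ∑ T ∈ S, cyl T := by
    rw [hβ, huR, ← Finset.sum_add_distrib]
    refine Finset.sum_congr rfl fun T _ => ?_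
    split_ifs <;> ring
  have hpsum : p12 + p1 + p2 = ∑ T ∈ S, cyl T := by
    rw [hp12, hp1, hp2, ← Finset.sum_add_distrib, ← Finset.sum_add_distrib]
    refine Finset.sum_congr rfl fun T _ => ?_
    split_ifs <;> ring
  have hβp12 : β ≤ p12 := by
    rw [hβ, hp12]
    refine Finset.sum_le_sum fun T _ => mul_le_mul_of_nonneg_left ?_ (hcyl_nonneg T)
    by_cases hb : br T
    · rw [if_pos hb, if_pos (hbr_both T hb)]
    · rw [if_neg hb]
      split_ifs <;> norm_num  -- the unglued `R`-restricted comparison and the glued target in terms of `EX`, `Δ₁`, `Δ₂`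
  have hRK : ∀ y, y ∉ N → (prodBernoulli K).real (R ∩ openConn y b) = ∑ T ∈ S, cyl T * (if br T then A12 y else A0 y) := by
    intro y hy
    rw [Set.inter_comm, hsum K]
    refine Finset.sum_congr rfl fun T hT => ?_
    rw [hvK T (hS T hT).1 y hy]
  have hG : (prodBernoulli K).real (R ∩ openConn w₁ b) - (prodBernoulli K).real (R ∩ openConn d b) =
      (A12 w₁ - A12 d) * β + (A0 w₁ - A0 d) * uR := by
    rw [hRK w₁ hw₁, hRK d hdN, hβ, huR, Finset.mul_sum, Finset.mul_sum, ← Finset.sum_sub_distrib, ← Finset.sum_add_distrib]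
    refine Finset.sum_congr rfl fun T _ => ?_
    split_ifs <;> ring
  have hV : (prodBernoulli g).real (R ∩ ⋃ v ∈ N, openConn v b) - (prodBernoulli g).real (R ∩ openConn d b) =
      (A12 w₁ - A12 d) * p12 + (A0 w₁ - A0 d) * p1 + (A0 w₂ - A0 d) * p2 := by
    rw [hgU, hgd, hp12, hp1, hp2, Finset.mul_sum, Finset.mul_sum, Finset.mul_sum, ← Finset.sum_sub_distrib,
      ← Finset.sum_add_distrib, ← Finset.sum_add_distrib]
    refine Finset.sum_congr rfl fun T _ => ?_
    split_ifs <;> ring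
  -- the algebra: V' − Γ₁ = (p12 − β)(EX − Δ₁) + p2(Δ₂ − Δ₁) ≥ 0
  have hu : uR = (p12 - β) + p1 + p2 := by linarith [hβu, hpsum]
  have key : ((A12 w₁ - A12 d) * p12 + (A0 w₁ - A0 d) * p1 + (A0 w₂ - A0 d) * p2) -
      ((A12 w₁ - A12 d) * β + (A0 w₁ - A0 d) * uR) =
      (p12 - β) * ((A12 w₁ - A12 d) - (A0 w₁ - A0 d)) + p2 * (A0 w₂ - A0 w₁) := by
    rw [hu]
    ring
  have e1 : 0 ≤ (p12 - β) * ((A12 w₁ - A12 d) - (A0 w₁ - A0 d)) := mul_nonneg (by linarith [hβp12]) hgain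
  have e2 : 0 ≤ p2 * (A0 w₂ - A0 w₁) := mul_nonneg hp2_nonneg (by linarith [hΔ₁₂])
  show (prodBernoulli K).real (R ∩ openConn w₁ b) - (prodBernoulli K).real (R ∩ openConn d b) ≤
    (prodBernoulli g).real (R ∩ ⋃ v ∈ N, openConn v b) - (prodBernoulli g).real (R ∩ openConn d b)
  linarith [hG, hV, key, e1, e2]

end FingerTwoContactsDomination

end

end Summit.CriticalPhenomena.PercolationContinuityZ3.Theorems
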